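import Literature.AlgebraicGeometry.Motives.FamiliesVHS
import Literature.AlgebraicGeometry.Motives.HodgeStructureDirectSum
import Literature.AlgebraicGeometry.Motives.UniversalHypersurfaceFamily
import HarnessLib

/-!
# Transport of Hodge structures and polarizations along linear equivalences; the polarized
# isomorphisms of fibre cohomologies carried by a `GeometricVHSData`

Layer `Literature/AlgebraicGeometry/Motives` (fact seat
`provefact-Literature.AlgebraicGeometry.Motives.uni-e6d3090000`, named fact
`Motives.universalSmoothHypersurfaceVHS` of `Motives/UniversalHypersurfaceFamily`). Everything in
this file is PROVED; no named fact is introduced.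

## Transport of structure (missing API)

* `HodgeStructure.comapEquiv H e` — the Hodge structure on `V` obtained from a Hodge structure
  `H` on `W` and a `ℚ`-linear equivalence `e : V ≃ₗ[ℚ] W`: `F^p V_ℂ := e_ℂ⁻¹ (F^p W_ℂ)`
  (Deligne, *Théorie de Hodge II*, 1.2.4–1.2.5, 2.1.4: the axioms are transported along the
  isomorphism `e_ℂ`, which commutes with complex conjugation); `comapEquiv_piece`,
  `comapEquiv_hodgeClasses`, `comapEquiv_symm_comapEquiv`.
* `HodgeStructure.Polarization.comapEquiv Q e` (`Q'(x, y) = Q(e x, e y)` polarizes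
  `H.comapEquiv e`), `Polarization.copy` (along an equality of Hodge structures),
  `Polarization.mapEquiv e Q` (a polarization of `H.comapEquiv e` pushed forward to `H`:
  `Q'(x, y) = Q(e⁻¹ x, e⁻¹ y)`); Voisin, *Hodge Theory I*, §7.1.2, Def. 7.7.

This is exactly the shape of the field `GeometricVHSData.hodge_F_eq` of `Motives/FamiliesVHS`
(`(hodge s).F p = (B.hodge _ i).F p` pulled back along `(fiberIso s)_ℂ`), whence:

## What a `GeometricVHSData` carries (Voisin I, §9.2.1, §10.1.3; Deligne, Hodge II, 4.1.1)

For `D : GeometricVHSData B f n i` (`B : BettiHodgeData ℂ`, `f : 𝒳 ⟶ S` a smooth projective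
family):
* `GeometricVHSData.hodge_eq_comapEquiv` — `D.hodge s = (B.hodge _ i).comapEquiv (D.fiberIso s)`;
* `GeometricVHSData.fiberPolarization D s` — the polarization `Q_s` of the Hodge structure
  `B.hodge _ i` of the fibre `Hⁱ(𝒳_s)` induced by `D.form s` (`fiberPolarization_form_fiberIso`);
* `GeometricVHSData.transportIso D γ : Hⁱ(𝒳_s) ≃ₗ[ℚ] Hⁱ(𝒳_t)` — parallel transport along a
  homotopy class of paths `γ` read on the cohomology of the fibres (Voisin I, §9.2.1: "the stalk
  of this local system at a point `t ∈ B` is canonically isomorphic to `Hᵏ(X_t, A)`"), with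
  `transportIso_refl`, `transportIso_trans`, and its three compatibilities:
  `fiberPolarization_transportIso` (an ISOMETRY `(Hⁱ(𝒳_s), Q_s) ≅ (Hⁱ(𝒳_t), Q_t)`; Voisin I,
  §10.1.3: "these identifications preserve the intersection form"), `transportIso_pullback`
  (restrictions of global classes are matched; Deligne, Hodge II, 4.1.1) and
  `image_transportIso_range_toRat` (the integral lattices `im(V_ℤ,s → Hⁱ(𝒳_s))` are matched;
  Voisin I, Rem. 10.17: "the integral structure … is flat").
* `universalSmoothHypersurfaceVHS.exists_flat_fiberPolarizations` — the consequence for the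
  named fact `universalSmoothHypersurfaceVHS` (which quantifies over EVERY `B : BettiCycleData`):
  it yields, for every `B`, polarizations `Q_s` of the Hodge structures `B.hodge` of ALL smooth
  hypersurfaces `Y_s` of degree `d` in `ℙⁿ⁺¹_ℂ` together with `ℚ`-linear isometries
  `(Hⁿ(Y_s), Q_s) ≅ (Hⁿ(Y_t), Q_t)` along every path in `U(ℂ)`, compatible with restriction from
  `Hⁿ(𝒴_U)` and carrying the lattice `Hⁿ(Y_s; ℤ)/tors` onto `Hⁿ(Y_t; ℤ)/tors`. The sources
  (Voisin I, §9.2.1, §10.1.3, Rem. 10.17; Voisin II, §6.2.1) prove this for THE Hodge structures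
  and THE intersection forms of the fibres; the fields of the hypothesis structure
  `BettiHodgeData` (`pullback_hom`, `polarizable`, `cycleClass_mem_hodgeClasses`) relate the
  abstract Hodge structures `B.hodge` of two fibres `Y_s`, `Y_t` only through morphisms of
  `ℂ`-schemes, so this necessary condition is a genuine hypothesis on `B` (compare the
  re-decorations `BettiHodgeData.conjugate`, `Motives/Sweep1HodgeRiemannConjugate`, and
  `BettiHodgeData.pureEven`, `Motives/BettiRealizationPure`).

## References

* C. Voisin, *Hodge Theory and Complex Algebraic Geometry I*, CUP 2002, §7.1.2 (Def. 7.7),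
  §9.2.1, §10.1.3, Rem. 10.17.
* C. Voisin, *Hodge Theory and Complex Algebraic Geometry II*, CUP 2003, §6.2.1.
* P. Deligne, *Théorie de Hodge II*, Publ. Math. IHÉS 40 (1971), 1.2.4–1.2.5, 2.1.4, 2.1.15,
  4.1.1.
-/

noncomputable section

open CategoryTheory AlgebraicGeometry
open scoped TensorProduct

namespace Literature.AlgebraicGeometry.Motives

namespace HodgeStructure

universe u v

variable {V : Type u} [AddCommGroup V] [Module ℚ V]
variable {W : Type v} [AddCommGroup W] [Module ℚ W]
variable {n : ℤ}

/-! ### Transport of a Hodge structure along a linear equivalence -/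

/-- `e_ℂ (e⁻¹_ℂ x) = x` for the complexifications of a `ℚ`-linear equivalence and its inverse.
[folklore] -/
theorem baseChange_apply_symm_baseChange (e : V ≃ₗ[ℚ] W) (x : ℂ ⊗[ℚ] W) :
    e.toLinearMap.baseChange ℂ (e.symm.toLinearMap.baseChange ℂ x) = x := by
  induction x using TensorProduct.induction_on with
  | zero => simp
  | tmul a w => simp
  | add x y hx hy => simp only [map_add, hx, hy]

/-- `e⁻¹_ℂ (e_ℂ x) = x` for the complexifications of a `ℚ`-linear equivalence and its inverse.
[folklore] -/
theorem symm_baseChange_apply_baseChange (e : V ≃ₗ[ℚ] W) (x : ℂ ⊗[ℚ] V) :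
    e.symm.toLinearMap.baseChange ℂ (e.toLinearMap.baseChange ℂ x) = x := by
  induction x using TensorProduct.induction_on with
  | zero => simp
  | tmul a w => simp
  | add x y hx hy => simp only [map_add, hx, hy]

/-- The complexification of a `ℚ`-linear equivalence is injective. [folklore] -/
theorem baseChange_injective_of_equiv (e : V ≃ₗ[ℚ] W) :
    Function.Injective (e.toLinearMap.baseChange ℂ) := fun x y h => by
  simpa only [symm_baseChange_apply_baseChange] using
    congrArg (e.symm.toLinearMap.baseChange ℂ) h

/-- **Transport of a Hodge structure along a linear equivalence.** For a Hodge structure `H` of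
weight `n` on `W` and `e : V ≃ₗ[ℚ] W`, the Hodge structure on `V` with `F^p V_ℂ = e_ℂ⁻¹(F^p W_ℂ)`;
the axioms (decreasing, finite, `n`-opposed to the conjugate filtration) are transported along
the `ℂ`-linear isomorphism `e_ℂ`, which commutes with complex conjugation
(Deligne, Hodge II, 1.2.4–1.2.5 and 2.1.4). [folklore] -/
def comapEquiv (H : HodgeStructure W n) (e : V ≃ₗ[ℚ] W) : HodgeStructure V n where
  F p := (H.F p).comap (e.toLinearMap.baseChange ℂ)
  antitone_F _ _ h := Submodule.comap_mono (H.antitone_F h)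
  exists_F_eq_top := by
    obtain ⟨p, hp⟩ := H.exists_F_eq_top
    exact ⟨p, by rw [hp, Submodule.comap_top]⟩
  exists_F_eq_bot := by
    obtain ⟨p, hp⟩ := H.exists_F_eq_bot
    refine ⟨p, ?_⟩
    rw [hp, Submodule.comap_bot]
    exact LinearMap.ker_eq_bot.2 (baseChange_injective_of_equiv e)
  isCompl_F_complexConj p q h := by
    rw [complexConj_comap_baseChange]
    exact (Submodule.orderIsoMapComap (e.baseChange ℚ ℂ V W)).symm.isCompl
      (H.isCompl_F_complexConj p q h)

/-- The Hodge filtration of the transported structure is the pulled-back filtration. [folklore] -/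
@[simp]
theorem comapEquiv_F (H : HodgeStructure W n) (e : V ≃ₗ[ℚ] W) (p : ℤ) :
    (H.comapEquiv e).F p = (H.F p).comap (e.toLinearMap.baseChange ℂ) := rfl

/-- The Hodge pieces of the transported structure are the pulled-back pieces
`V^{p,q} = e_ℂ⁻¹ (W^{p,q})`. [folklore] -/
theorem comapEquiv_piece (H : HodgeStructure W n) (e : V ≃ₗ[ℚ] W) (p q : ℤ) :
    (H.comapEquiv e).piece p q = (H.piece p q).comap (e.toLinearMap.baseChange ℂ) := by
  by_cases h : p + q = n
  · rw [piece_of_add_eq _ h, piece_of_add_eq _ h, comapEquiv_F, comapEquiv_F,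
      complexConj_comap_baseChange, Submodule.comap_inf]
  · rw [piece_eq_bot_of_add_ne _ h, piece_eq_bot_of_add_ne _ h, Submodule.comap_bot]
    exact (LinearMap.ker_eq_bot.2 (baseChange_injective_of_equiv e)).symm

/-- The Hodge classes of the transported structure are the pulled-back Hodge classes
`Hdgᵖ(V) = e⁻¹ (Hdgᵖ(W))`. [folklore] -/
theorem comapEquiv_hodgeClasses (H : HodgeStructure W n) (e : V ≃ₗ[ℚ] W) (p : ℤ) :
    (H.comapEquiv e).hodgeClasses p = (H.hodgeClasses p).comap e.toLinearMap := by
  ext v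
  rw [mem_hodgeClasses_iff, Submodule.mem_comap, mem_hodgeClasses_iff, comapEquiv_F,
    Submodule.mem_comap, baseChange_ofRat]

/-- Transporting along `e` and then along `e⁻¹` gives back `H`. [folklore] -/
@[simp]
theorem comapEquiv_symm_comapEquiv (H : HodgeStructure W n) (e : V ≃ₗ[ℚ] W) :
    (H.comapEquiv e).comapEquiv e.symm = H := by
  ext p x
  simp only [comapEquiv_F, Submodule.mem_comap, baseChange_apply_symm_baseChange]

/-- Transporting along `e⁻¹` and then along `e` gives back `H`. [folklore] -/
@[simp]
theorem comapEquiv_comapEquiv_symm (H : HodgeStructure V n) (e : V ≃ₗ[ℚ] W) :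
    (H.comapEquiv e.symm).comapEquiv e = H := by
  ext p x
  simp only [comapEquiv_F, Submodule.mem_comap, symm_baseChange_apply_baseChange]

/-! ### Transport of polarizations -/

/-- **A polarization `Q` of `H` polarizes the transported structure `H.comapEquiv e` by
`Q'(x, y) = Q(e x, e y)`**: both Hodge–Riemann relations are read through `e_ℂ`, which carries
`F^p V_ℂ` into `F^p W_ℂ`, `V^{p,q}` into `W^{p,q}` and commutes with conjugation
(Voisin I, §7.1.2, Def. 7.7; Deligne, Hodge II, 2.1.15). [folklore] -/
def Polarization.comapEquiv {H : HodgeStructure W n} (Q : Polarization H) (e : V ≃ₗ[ℚ] W) :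
    Polarization (H.comapEquiv e) where
  form := Q.form.compl₁₂ e.toLinearMap e.toLinearMap
  flip_form := by
    refine LinearMap.ext fun x ↦ LinearMap.ext fun y ↦ ?_
    have h := LinearMap.congr_fun₂ Q.flip_form (e x) (e y)
    simp only [LinearMap.BilinForm.flip_apply, LinearMap.smul_apply, LinearMap.compl₁₂_apply,
      LinearEquiv.coe_coe] at h ⊢
    exact h
  form_apply_eq_zero p x hx y hy := by
    rw [comapEquiv_F, Submodule.mem_comap] at hx hy
    rw [baseChange_compl₁₂]
    exact Q.form_apply_eq_zero p _ hx _ hy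
  pos p q hpq x hx hx0 := by
    rw [comapEquiv_piece, Submodule.mem_comap] at hx
    have hx0' : e.toLinearMap.baseChange ℂ x ≠ 0 := fun h ↦
      hx0 (baseChange_injective_of_equiv e (by rw [h, map_zero]))
    obtain ⟨r, hr, hQ⟩ := Q.pos p q hpq _ hx hx0'
    refine ⟨r, hr, ?_⟩
    rw [baseChange_compl₁₂, ← conj_baseChange]
    exact hQ

/-- The form of `Q.comapEquiv e` is `Q(e x, e y)`. [folklore] -/
@[simp]
theorem Polarization.comapEquiv_form_apply {H : HodgeStructure W n} (Q : Polarization H)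
    (e : V ≃ₗ[ℚ] W) (x y : V) : (Q.comapEquiv e).form x y = Q.form (e x) (e y) := rfl

/-- A polarization transported along an equality of Hodge structures (same form). [folklore] -/
def Polarization.copy {H₁ H₂ : HodgeStructure V n} (Q : Polarization H₁) (h : H₁ = H₂) :
    Polarization H₂ := h ▸ Q

/-- `Q.copy h` has the same form as `Q`. [folklore] -/
@[simp]
theorem Polarization.copy_form {H₁ H₂ : HodgeStructure V n} (Q : Polarization H₁) (h : H₁ = H₂) :
    (Q.copy h).form = Q.form := by
  subst h
  rfl

/-- **Push-forward of a polarization along a linear equivalence**: a polarization `Q` of the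
transported structure `H.comapEquiv e` gives the polarization `Q'(x, y) = Q(e⁻¹ x, e⁻¹ y)` of `H`
(Voisin I, §7.1.2, Def. 7.7, read through the isomorphism `e`). [folklore] -/
def Polarization.mapEquiv {H : HodgeStructure W n} (e : V ≃ₗ[ℚ] W)
    (Q : Polarization (H.comapEquiv e)) : Polarization H :=
  (Q.comapEquiv e.symm).copy (H.comapEquiv_symm_comapEquiv e)

/-- The form of `Q.mapEquiv e` is `Q(e⁻¹ x, e⁻¹ y)`. [folklore] -/
@[simp]
theorem Polarization.mapEquiv_form_apply {H : HodgeStructure W n} (e : V ≃ₗ[ℚ] W)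
    (Q : Polarization (H.comapEquiv e)) (x y : W) :
    (Q.mapEquiv e).form x y = Q.form (e.symm x) (e.symm y) := by
  rw [Polarization.mapEquiv, Polarization.copy_form]
  rfl

/-- A Hodge structure isomorphic (along a linear equivalence) to a polarizable one is
polarizable. [folklore] -/
theorem IsPolarizable.comapEquiv {H : HodgeStructure W n} (hH : H.IsPolarizable) (e : V ≃ₗ[ℚ] W) :
    (H.comapEquiv e).IsPolarizable :=
  ⟨hH.some.comapEquiv e⟩

end HodgeStructure

/-! ### The polarized isomorphisms of fibre cohomologies carried by a `GeometricVHSData` -/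

namespace GeometricVHSData

variable {B : BettiHodgeData ℂ} {𝒳 S : SchemeOver ℂ} {f : 𝒳 ⟶ S} {n i : ℕ}
  (D : GeometricVHSData B f n i)

/-- The fibrewise Hodge structure of a geometric VHS datum IS the Hodge structure `B.hodge` of the
fibre, transported along `fiberIso s` (a restatement of the field `hodge_F_eq`). [folklore] -/
theorem hodge_eq_comapEquiv (s : ComplexPoints S) :
    D.hodge s = (B.hodge (D.isSmoothProjective_fiberOver s) i).comapEquiv (D.fiberIso s) :=
  HodgeStructure.ext (funext fun p => D.hodge_F_eq s p)

/-- **The polarization of `Hⁱ(𝒳_s)` carried by the datum**: the flat form `D.form s` read on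
`Hⁱ(𝒳_s)` through `fiberIso s`, a polarization of the Hodge structure `B.hodge` of the smooth
projective fibre (Voisin I, §10.1.3: the intersection form polarizes the Hodge structure of every
fibre). [folklore] -/
def fiberPolarization (s : ComplexPoints S) :
    (B.hodge (D.isSmoothProjective_fiberOver s) i).Polarization :=
  ((D.form s).copy (D.hodge_eq_comapEquiv s)).mapEquiv (D.fiberIso s)

/-- The form of `fiberPolarization s` is `Q_s((fiberIso s)⁻¹ x, (fiberIso s)⁻¹ y)`. [folklore] -/
theorem fiberPolarization_form_apply (s : ComplexPoints S) (x y : B.W.obj (fiberOver f s) i) :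
    (D.fiberPolarization s).form x y =
      (D.form s).form ((D.fiberIso s).symm x) ((D.fiberIso s).symm y) := by
  rw [fiberPolarization, HodgeStructure.Polarization.mapEquiv_form_apply,
    HodgeStructure.Polarization.copy_form]

/-- `fiberIso s` is an isometry `(V_s, Q_s) ≅ (Hⁱ(𝒳_s), fiberPolarization s)`. [folklore] -/
theorem fiberPolarization_form_fiberIso (s : ComplexPoints S) (x y : D.V.fiber s) :
    (D.fiberPolarization s).form (D.fiberIso s x) (D.fiberIso s y) = (D.form s).form x y := by
  rw [fiberPolarization_form_apply, LinearEquiv.symm_apply_apply, LinearEquiv.symm_apply_apply]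

/-- **Parallel transport read on the cohomology of the fibres**: `Hⁱ(𝒳_s) ≃ₗ[ℚ] Hⁱ(𝒳_t)` along a
homotopy class of paths `γ` from `s` to `t`, i.e. `fiberIso t ∘ γ_* ∘ (fiberIso s)⁻¹`
(Voisin I, §9.2.1: the stalks of `Rⁱf_*ℚ` are the cohomology of the fibres). [folklore] -/
def transportIso {s t : ComplexPoints S} (γ : Path.Homotopic.Quotient s t) :
    B.W.obj (fiberOver f s) i ≃ₗ[ℚ] B.W.obj (fiberOver f t) i :=
  (D.fiberIso s).symm ≪≫ₗ D.V.transportEquiv γ ≪≫ₗ D.fiberIso t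

/-- `transportIso` unfolded. [folklore] -/
theorem transportIso_apply {s t : ComplexPoints S} (γ : Path.Homotopic.Quotient s t)
    (x : B.W.obj (fiberOver f s) i) :
    D.transportIso γ x = D.fiberIso t (D.V.transport γ ((D.fiberIso s).symm x)) := rfl

/-- Transport along the constant path is the identity (functoriality of the local system).
[folklore] -/
theorem transportIso_refl (s : ComplexPoints S) (x : B.W.obj (fiberOver f s) i) :
    D.transportIso (Path.Homotopic.Quotient.refl s) x = x := by
  rw [transportIso_apply, LocalSystem.transport_refl, LinearMap.id_apply,
    LinearEquiv.apply_symm_apply]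

/-- Transport is compatible with concatenation of paths (functoriality of the local system).
[folklore] -/
theorem transportIso_trans {s t w : ComplexPoints S} (γ : Path.Homotopic.Quotient s t)
    (δ : Path.Homotopic.Quotient t w) (x : B.W.obj (fiberOver f s) i) :
    D.transportIso (γ.trans δ) x = D.transportIso δ (D.transportIso γ x) := by
  rw [transportIso_apply, transportIso_apply, transportIso_apply, LocalSystem.transport_trans,
    LinearMap.comp_apply, LinearEquiv.symm_apply_apply]

/-- **Transport is an isometry of the polarized fibres** `(Hⁱ(𝒳_s), Q_s) ≅ (Hⁱ(𝒳_t), Q_t)`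
(flatness of the polarization, field `transport_form`; Voisin I, §10.1.3: "these
identifications preserve the intersection form"). [cite: VoisinHodgeI2002, §10.1.3] -/
theorem fiberPolarization_transportIso {s t : ComplexPoints S} (γ : Path.Homotopic.Quotient s t)
    (x y : B.W.obj (fiberOver f s) i) :
    (D.fiberPolarization t).form (D.transportIso γ x) (D.transportIso γ y) =
      (D.fiberPolarization s).form x y := by
  rw [transportIso_apply, transportIso_apply, fiberPolarization_form_fiberIso, D.transport_form,
    fiberPolarization_form_apply]

/-- **Transport matches the restrictions of a global class**: `γ_* (x|_{𝒳_s}) = x|_{𝒳_t}` for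
`x ∈ Hⁱ(𝒳)` (field `transport_restrict`; Deligne, Hodge II, 4.1.1). [folklore] -/
theorem transportIso_pullback {s t : ComplexPoints S} (γ : Path.Homotopic.Quotient s t)
    (x : B.W.obj 𝒳 i) :
    D.transportIso γ (B.W.pullback (fiberι f s) i x) = B.W.pullback (fiberι f t) i x := by
  have h := D.transport_restrict_apply γ x
  rw [restrict_apply, restrict_apply] at h
  rw [transportIso_apply, h, LinearEquiv.apply_symm_apply]

/-- `transportIso_pullback` as an identity of linear maps `Hⁱ(𝒳) → Hⁱ(𝒳_t)`. [folklore] -/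
theorem transportIso_comp_pullback {s t : ComplexPoints S} (γ : Path.Homotopic.Quotient s t) :
    (D.transportIso γ).toLinearMap ∘ₗ B.W.pullback (fiberι f s) i = B.W.pullback (fiberι f t) i :=
  LinearMap.ext (D.transportIso_pullback γ)

/-- Transport carries the image of an integral vector `u ∈ V_ℤ,s` to the image of the transported
integral vector (naturality of `ratIso`; Voisin I, Rem. 10.17: the integral structure is flat).
[cite: VoisinHodgeI2002, Rem. 10.17] -/
theorem transportIso_fiberIso_toRat {s t : ComplexPoints S} (γ : Path.Homotopic.Quotient s t)
    (u : D.VZ.fiber s) :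
    D.transportIso γ (D.fiberIso s (D.toRat s u)) = D.fiberIso t (D.toRat t (D.VZ.transport γ u)) := by
  rw [transportIso_apply, LinearEquiv.symm_apply_apply, D.transport_toRat]

/-- **Transport carries the integral lattice of `Hⁱ(𝒳_s)` onto that of `Hⁱ(𝒳_t)`**: the image of
`V_ℤ,s → V_s ≃ Hⁱ(𝒳_s)` is mapped onto the image of `V_ℤ,t → V_t ≃ Hⁱ(𝒳_t)` (Voisin I, Rem. 10.17).
[cite: VoisinHodgeI2002, Rem. 10.17] -/
theorem image_transportIso_range_toRat {s t : ComplexPoints S} (γ : Path.Homotopic.Quotient s t) :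
    D.transportIso γ '' Set.range (fun u : D.VZ.fiber s => D.fiberIso s (D.toRat s u)) =
      Set.range (fun u : D.VZ.fiber t => D.fiberIso t (D.toRat t u)) := by
  ext y
  simp only [Set.mem_image, Set.mem_range]
  constructor
  · rintro ⟨_, ⟨u, rfl⟩, rfl⟩
    exact ⟨D.VZ.transport γ u, (D.transportIso_fiberIso_toRat γ u).symm⟩
  · rintro ⟨u, rfl⟩
    refine ⟨D.fiberIso s (D.toRat s ((D.VZ.transportEquiv γ).symm u)), ⟨_, rfl⟩, ?_⟩
    rw [transportIso_fiberIso_toRat, ← LocalSystem.coe_transportEquiv, LinearEquiv.coe_coe,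
      LinearEquiv.apply_symm_apply]

end GeometricVHSData

/-! ### The consequence for `universalSmoothHypersurfaceVHS` -/

section UniversalFamily

/-- **What `universalSmoothHypersurfaceVHS` asserts about an arbitrary `B : BettiCycleData`.**
The named fact (quantified over EVERY `B`) yields, for every `B` and all `n, d ≥ 1`:
polarizations `Q_s` of the Hodge structures `B.hodge` on `Hⁿ(Y_s)` of ALL smooth hypersurfaces
`Y_s ⊂ ℙⁿ⁺¹_ℂ` of degree `d`, and along every homotopy class of paths in `U(ℂ)` a `ℚ`-linear
ISOMETRY `(Hⁿ(Y_s), Q_s) ≅ (Hⁿ(Y_t), Q_t)` which matches the restrictions of global classes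
from `Hⁿ(𝒴_U)` and carries the lattice `Hⁿ(Y_s; ℤ)/tors` (the image of `B.intToRat`, read in
`B.W` through `B.isoObj⁻¹`) onto `Hⁿ(Y_t; ℤ)/tors`. The sources prove this for THE Hodge
structures and THE intersection forms (Voisin I, §9.2.1, §10.1.3, Rem. 10.17; Voisin II, §6.2.1);
for an abstract `B` — whose fields relate the Hodge structures of two fibres only through
morphisms of `ℂ`-schemes — it is a genuine hypothesis on `B`. [cite: VoisinHodgeI2002, §10.1.3 and Rem. 10.17] -/
theorem universalSmoothHypersurfaceVHS.exists_flat_fiberPolarizations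
    (h : universalSmoothHypersurfaceVHS) (B : BettiCycleData) {n d : ℕ} (hn : 1 ≤ n)
    (hd : 1 ≤ d) :
    ∃ (hf : IsSmoothProjectiveFamily (UniversalHypersurface.family ℂ n d) n)
      (Q : ∀ s : ComplexPoints (UniversalHypersurface.base ℂ n d),
        (B.hodge (hf.isSmoothProjective s) n).Polarization)
      (φ : ∀ ⦃s t : ComplexPoints (UniversalHypersurface.base ℂ n d)⦄, Path.Homotopic.Quotient s t →
        (B.W.obj (fiberOver (UniversalHypersurface.family ℂ n d) s) n ≃ₗ[ℚ]
          B.W.obj (fiberOver (UniversalHypersurface.family ℂ n d) t) n)),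
      (∀ (s t : ComplexPoints (UniversalHypersurface.base ℂ n d))
          (γ : Path.Homotopic.Quotient s t) (x y), (Q t).form (φ γ x) (φ γ y) = (Q s).form x y) ∧
      (∀ (s t : ComplexPoints (UniversalHypersurface.base ℂ n d))
          (γ : Path.Homotopic.Quotient s t) (x),
          φ γ (B.W.pullback (fiberι (UniversalHypersurface.family ℂ n d) s) n x) =
            B.W.pullback (fiberι (UniversalHypersurface.family ℂ n d) t) n x) ∧
      (∀ (s t : ComplexPoints (UniversalHypersurface.base ℂ n d))
          (γ : Path.Homotopic.Quotient s t),
          φ γ '' Set.range (fun x : bettiCohomologyInt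
              (fiberOver (UniversalHypersurface.family ℂ n d) s) n =>
            (B.isoObj (fiberOver (UniversalHypersurface.family ℂ n d) s) n).symm
              (B.intToRat (fiberOver (UniversalHypersurface.family ℂ n d) s) n x)) =
          Set.range (fun x : bettiCohomologyInt
              (fiberOver (UniversalHypersurface.family ℂ n d) t) n =>
            (B.isoObj (fiberOver (UniversalHypersurface.family ℂ n d) t) n).symm
              (B.intToRat (fiberOver (UniversalHypersurface.family ℂ n d) t) n x))) := by
  obtain ⟨D, hD⟩ := h B n d hn hd
  refine ⟨D.isSmoothProjectiveFamily, D.fiberPolarization, fun s t γ => D.transportIso γ,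
    fun s t γ x y => D.fiberPolarization_transportIso γ x y,
    fun s t γ x => D.transportIso_pullback γ x, fun s t γ => ?_⟩
  rw [← hD s, ← hD t]
  exact D.image_transportIso_range_toRat γ

end UniversalFamily

end Literature.AlgebraicGeometry.Motives

end
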